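import Summits.AtomisticToContinuum.Crystallization.Theorems.OverbindingBudgetAffineCompressedCutPatchTwo

/-!
# Overbinding budget — compressed cut: R4 «LR(r₁)» V — THE BOX STACK RUN (layer recursion on axis-centred patches)

Record: route `OverbindingBudget`, crux `RobustDefectLimitWindows` (stmt-AtomisticToContinuum-31280); open leaf NS♭₂ ⟸ 79K ⟸ LR(r₁); R4 «LR(r₁)».
Continuation of `…CompressedCutPatchTwo`; REPLACES `…Run.stack_run` at the record.

* §0 the column `column λ₀ sg m = λ₀ + m·sg·(2,2,2)` and label / box identities.
* §1 ★★ `stack_run_box` — from a base patch (every layer vector of the box `InBox 0 K₀` about `λ₀` labels an established site on one copy `C₀`)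
  and `L + 1 ≤ K₀`: offset and class sequences `offs m` (sum-zero, `offs (m+1) = offs m + ε_m·(1,1,−2)`), `Cs m ∈ {F⁺, F⁻, H, H′}` such that at
  every level `m ≤ L` every layer vector `x` of the box `InBox (offs m) (K₀ − m)` labels an established site charted onto `Cs m` at
  `column λ₀ sg m + offs m + x`, bounds `(τs m, Ds m)`, scale in `[νs m, ν′s m]`.  Per level: `…PatchTwo.layer_climb_box_four` then
  `…PatchTwo.patch_uniform`.  Side conditions per level: the bound recursions (`hτ hD hν hν'`), the three resolution inequalities (`hΔ hsmall hΔk`),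
  site identification at the new level (`hid`), monotonicity of the room bound (`hmono`), and ROOM stated on the COLUMN:
  `γ‖mv(column (m+1) + t)‖ + (Ds (m+1) + 10⁻⁴ν′s (m+1) + τs (m+1)) ≤ r` for sum-zero `t` in the box `K₀ − (m+1)` — a pure function of the designated
  numbers (no reach, no chart-gap hypothesis).  The patch inradius about the column is `(K₀ − m)/(2√3)` nn: loss `0.2887` nn per level, no drift.
* §2 `patch_of_disc` — a regular layer disc of hex radius `n` (R2 `…Seed.layer_disc_fcc_ball`, `…OffDisc.layer_disc_off_hcp`) is the base box
  `InBox 0 (3n)`.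

Deps: `…CompressedCutPatchTwo`.  No `instance`, no `notation`, no `set_option`, no new axioms, 0 sorry.
-/

namespace Summit.AtomisticToContinuum.Crystallization.Theorems.OverbindingBudgetAffineCompressedCutRunBox

open Literature.Geometry.DiscreteGeometry (nearestDist nearestDist_nonneg fccTwoShellPattern hcpTwoShellPattern)
open Summit.AtomisticToContinuum.Crystallization.Theorems.OverbindingBudgetAffineCompressedCutKernel (T3 tsub tadd tsq thsum fccL hcpL fccNegL
  hcpAltL hexL capL)
open Summit.AtomisticToContinuum.Crystallization.Theorems.OverbindingBudgetAffineCompressedCutCharts (mv norm_mv_eq_one_iff)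
open Summit.AtomisticToContinuum.Crystallization.Theorems.OverbindingBudgetAffineCompressedCutEstablish (Estab)
open Summit.AtomisticToContinuum.Crystallization.Theorems.OverbindingBudgetAffineCompressedCutSeed (InLayer lnorm estab_mono tadd_zero_right)
open Summit.AtomisticToContinuum.Crystallization.Theorems.OverbindingBudgetAffineCompressedCutRun (thsum_tadd mem_four_of_singleton)
open Summit.AtomisticToContinuum.Crystallization.Theorems.OverbindingBudgetAffineCompressedCutPatch (InBox capv dL thsum_capv lnorm_le_of_inBox)
open Summit.AtomisticToContinuum.Crystallization.Theorems.OverbindingBudgetAffineCompressedCutPatchTwo (layer_climb_box_four patch_uniform)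

variable {N : ℕ}

/-! ## §0  The column and label identities -/

/-- The column label at level `m`: `λ₀ + m·sg·(2,2,2)` (the point of layer `m` straight above / below the base reference label). [this file] -/
def column (lam₀ : T3) (sg m : ℤ) : T3 := tadd lam₀ (2 * sg * m, 2 * sg * m, 2 * sg * m)

/-- `column λ₀ sg 0 = λ₀`. [this file] -/
theorem column_zero (lam₀ : T3) (sg : ℤ) : column lam₀ sg 0 = lam₀ := by
  simp only [column, mul_zero]
  exact tadd_zero_right lam₀

/-- Label identity for the climb: `((column m + o) + capv sg ε δ) + x = column (m+1) + ((o + capv 0 ε δ) + x)`. [this file] -/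
theorem column_climb (lam₀ o x δ : T3) (sg ε m : ℤ) :
    tadd (tadd (tadd (column lam₀ sg m) o) (capv sg ε δ)) x = tadd (column lam₀ sg (m + 1)) (tadd (tadd o (capv 0 ε δ)) x) := by
  obtain ⟨l₁, l₂, l₃⟩ := lam₀; obtain ⟨o₁, o₂, o₃⟩ := o; obtain ⟨x₁, x₂, x₃⟩ := x; obtain ⟨d₁, d₂, d₃⟩ := δ
  simp only [column, tadd, capv, Prod.mk.injEq]
  refine ⟨by ring, by ring, by ring⟩

/-- Label identity for the new level: `(column m + o) + capv sg ε δ = column (m+1) + (o + capv 0 ε δ)`. [this file] -/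
theorem column_step (lam₀ o δ : T3) (sg ε m : ℤ) :
    tadd (tadd (column lam₀ sg m) o) (capv sg ε δ) = tadd (column lam₀ sg (m + 1)) (tadd o (capv 0 ε δ)) := by
  obtain ⟨l₁, l₂, l₃⟩ := lam₀; obtain ⟨o₁, o₂, o₃⟩ := o; obtain ⟨d₁, d₂, d₃⟩ := δ
  simp only [column, tadd, capv, Prod.mk.injEq]
  refine ⟨by ring, by ring, by ring⟩

/-- Box with offset `o` about the column = box with offset `0` of the column coordinates `o + x`. [this file] -/
theorem inBox_zero_tadd {o x : T3} {K : ℤ} (h : InBox o K x) : InBox (0, 0, 0) K (tadd o x) := by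
  obtain ⟨h1, h2, h3⟩ := h
  simp only [InBox, tadd, add_zero, abs_le] at h1 h2 h3 ⊢
  omega

/-- The column coordinates of a child are sum-zero. [this file] -/
theorem thsum_child {o x δ : T3} {ε : ℤ} (ho : thsum o = 0) (hx : InLayer x) (hδ : δ ∈ dL) : thsum (tadd (tadd o (capv 0 ε δ)) x) = 0 := by
  rw [thsum_tadd, thsum_tadd, thsum_capv hδ, ho, mul_zero, add_zero, zero_add]
  exact hx.1

/-! ## §1  The box stack run -/

/-- ★★ **THE BOX STACK RUN.**  See the module docstring. [this file] -/
theorem stack_run_box {y : Fin N → EuclideanSpace ℝ (Fin 3)} (hy : Function.Injective y) {r : ℝ} {i : Fin N}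
    {A : Fin N → (EuclideanSpace ℝ (Fin 3) →ₗ[ℝ] EuclideanSpace ℝ (Fin 3))} {Qf : Fin N → (EuclideanSpace ℝ (Fin 3) →ₗᵢ[ℝ] EuclideanSpace ℝ (Fin 3))}
    {P : Fin N → Finset (EuclideanSpace ℝ (Fin 3))} {f : Fin N → EuclideanSpace ℝ (Fin 3) → EuclideanSpace ℝ (Fin 3)}
    {B : EuclideanSpace ℝ (Fin 3) →ₗ[ℝ] EuclideanSpace ℝ (Fin 3)} {β γ : ℝ}
    (hP : ∀ j, dist (y j) (y i) ≤ r → (P j = fccTwoShellPattern ∨ P j = hcpTwoShellPattern))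
    (hA : ∀ j, dist (y j) (y i) ≤ r → ∀ v ∈ P j, ‖A j v - Qf j v‖ ≤ 1 / 1000)
    (hf : ∀ j, dist (y j) (y i) ≤ r → ∀ v ∈ P j, f j v ∈ Set.range y ∧ dist (f j v) (y j + nearestDist y j • A j v) ≤ 1 / 10 ^ 4 * nearestDist y j)
    (hinj : ∀ j, dist (y j) (y i) ≤ r → Set.InjOn (f j) ↑(P j))
    (hex : ∀ j, dist (y j) (y i) ≤ r → ∀ m, m ≠ j → dist (y m) (y j) ≤ (3 / 2 + 1 / 450) * nearestDist y j → ∃ v ∈ P j, f j v = y m)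
    (hB : ∀ z, β * ‖z‖ ≤ ‖B z‖) (hBup : ∀ z, ‖B z‖ ≤ γ * ‖z‖)
    {sg : ℤ} (hsg : sg = 1 ∨ sg = -1) {C₀ : List T3} (hC₀ : C₀ ∈ [fccL, fccNegL, hcpL, hcpAltL]) {lam₀ : T3}
    {τs Ds νs ν's : ℕ → ℝ} {K₀ : ℤ} {L : ℕ} (hL : (L : ℤ) + 1 ≤ K₀)
    (hbase : ∀ x, InLayer x → InBox (0, 0, 0) K₀ x → ∃ k : Fin N, ∃ M : EuclideanSpace ℝ (Fin 3) →ₗᵢ[ℝ] EuclideanSpace ℝ (Fin 3),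
      dist (y k) (y i) ≤ r ∧ νs 0 ≤ nearestDist y k ∧ nearestDist y k ≤ ν's 0 ∧ Estab y A P B i k M C₀ (tadd lam₀ x) (τs 0) (Ds 0))
    (hτ : ∀ m, m < L → τs m + 5 / 2 * (2 * (1 / 10 ^ 4) * ν's m + 1 / 10 ^ 4 * (10011 / 10000 * ν's m)) ≤ τs (m + 1))
    (hD : ∀ m, m < L → Ds m + 1 / 10 ^ 4 * ν's m + τs m ≤ Ds (m + 1))
    (hν : ∀ m, m < L → νs (m + 1) ≤ 9967 / 10000 * νs m) (hν' : ∀ m, m < L → 10011 / 10000 * ν's m ≤ ν's (m + 1))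
    (hΔ : ∀ m, m < L → 2 * Ds m + 1 / 10 ^ 4 * ν's m + τs m < νs m)
    (hsmall : ∀ m, m < L → (2 * τs m + 5 / 2 * (3 / 10 ^ 4 * ν's m)) * Real.sqrt 2 < β)
    (hΔk : ∀ m, m < L → 2 * Ds m + 2 / 10 ^ 4 * ν's m + 2 * τs m < 9967 / 10000 * νs m)
    (hid : ∀ m, m < L → (Ds (m + 1) + 1 / 10 ^ 4 * ν's (m + 1) + τs (m + 1)) + Ds (m + 1) < νs (m + 1))
    (hmono : ∀ m, m < L → Ds m + 1 / 10 ^ 4 * ν's m + τs m ≤ Ds (m + 1) + 1 / 10 ^ 4 * ν's (m + 1) + τs (m + 1))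
    (hroom : ∀ m, m < L → ∀ t : T3, thsum t = 0 → InBox (0, 0, 0) (K₀ - ((m : ℤ) + 1)) t →
      γ * ‖mv (tadd (column lam₀ sg ((m : ℤ) + 1)) t)‖ + (Ds (m + 1) + 1 / 10 ^ 4 * ν's (m + 1) + τs (m + 1)) ≤ r) :
    ∃ offs : ℕ → T3, ∃ Cs : ℕ → List T3, offs 0 = (0, 0, 0) ∧ Cs 0 = C₀ ∧
      (∀ m, m < L → ∃ ε : ℤ, (ε = 1 ∨ ε = -1) ∧ (∀ δ ∈ dL, capv sg ε δ ∈ capL (Cs m) sg) ∧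
        offs (m + 1) = tadd (offs m) (capv 0 ε (1, 1, -2))) ∧
      ∀ m, m ≤ L → Cs m ∈ [fccL, fccNegL, hcpL, hcpAltL] ∧ thsum (offs m) = 0 ∧
        ∀ x, InLayer x → InBox (offs m) (K₀ - (m : ℤ)) x →
          ∃ k : Fin N, ∃ M : EuclideanSpace ℝ (Fin 3) →ₗᵢ[ℝ] EuclideanSpace ℝ (Fin 3),
            dist (y k) (y i) ≤ r ∧ νs m ≤ nearestDist y k ∧ nearestDist y k ≤ ν's m ∧
            Estab y A P B i k M (Cs m) (tadd (tadd (column lam₀ sg (m : ℤ)) (offs m)) x) (τs m) (Ds m) := by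
  have d0 : ((1, 1, -2) : T3) ∈ dL := by decide
  -- induction on the number of climbs `L' ≤ L`
  suffices H : ∀ L', L' ≤ L → ∃ offs : ℕ → T3, ∃ Cs : ℕ → List T3, offs 0 = (0, 0, 0) ∧ Cs 0 = C₀ ∧
      (∀ m, m < L' → ∃ ε : ℤ, (ε = 1 ∨ ε = -1) ∧ (∀ δ ∈ dL, capv sg ε δ ∈ capL (Cs m) sg) ∧
        offs (m + 1) = tadd (offs m) (capv 0 ε (1, 1, -2))) ∧
      ∀ m, m ≤ L' → Cs m ∈ [fccL, fccNegL, hcpL, hcpAltL] ∧ thsum (offs m) = 0 ∧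
        ∀ x, InLayer x → InBox (offs m) (K₀ - (m : ℤ)) x →
          ∃ k : Fin N, ∃ M : EuclideanSpace ℝ (Fin 3) →ₗᵢ[ℝ] EuclideanSpace ℝ (Fin 3),
            dist (y k) (y i) ≤ r ∧ νs m ≤ nearestDist y k ∧ nearestDist y k ≤ ν's m ∧
            Estab y A P B i k M (Cs m) (tadd (tadd (column lam₀ sg (m : ℤ)) (offs m)) x) (τs m) (Ds m) from H L le_rfl
  intro L'
  induction L' with
  | zero =>
    intro _
    refine ⟨fun _ => (0, 0, 0), fun _ => C₀, rfl, rfl, fun m hm => absurd hm (Nat.not_lt_zero m), fun m hm => ?_⟩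
    have hm0 : m = 0 := Nat.le_zero.1 hm
    subst hm0
    refine ⟨hC₀, by simp [thsum], fun x hx hb => ?_⟩
    rw [Nat.cast_zero, column_zero, tadd_zero_right, sub_zero] at *
    exact hbase x hx hb
  | succ L' ih =>
    intro hL'
    have hL'L : L' < L := hL'
    obtain ⟨offs, Cs, h0, hC0, hstep, hlev⟩ := ih hL'L.le
    obtain ⟨hCL, hth, hpatch⟩ := hlev L' le_rfl
    have hK : (2 : ℤ) ≤ K₀ - (L' : ℤ) := by push_cast [Nat.lt_iff_add_one_le] at hL'L ⊢; omega
    have hK1 : K₀ - (((L' + 1 : ℕ) : ℤ)) = K₀ - (L' : ℤ) - 1 := by push_cast; ring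
    have hK2 : K₀ - ((L' : ℤ) + 1) = K₀ - (L' : ℤ) - 1 := by ring
    have hc1 : (((L' + 1 : ℕ) : ℤ)) = (L' : ℤ) + 1 := by push_cast; ring
    -- ROOM at the child labels (both bounds)
    have hroomB : ∀ ε : ℤ, ∀ x, InLayer x → InBox (tadd (offs L') (capv 0 ε (1, 1, -2))) (K₀ - (L' : ℤ) - 1) x →
        ‖B (mv (tadd (tadd (tadd (column lam₀ sg (L' : ℤ)) (offs L')) (capv sg ε (1, 1, -2))) x))‖ +
          (Ds (L' + 1) + 1 / 10 ^ 4 * ν's (L' + 1) + τs (L' + 1)) ≤ r := by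
      intro ε x hx hb
      rw [column_climb]
      have h1 := hBup (mv (tadd (column lam₀ sg ((L' : ℤ) + 1)) (tadd (tadd (offs L') (capv 0 ε (1, 1, -2))) x)))
      have h2 := hroom L' hL'L _ (thsum_child hth hx d0) (by rw [hK2]; exact inBox_zero_tadd hb)
      linarith
    obtain ⟨ε, hε, hcaps, Qa, Qb, hQa, hQb, hnew⟩ := layer_climb_box_four hy hP hA hf hinj hex hB hCL hsg hth hK hpatch (hΔ L' hL'L)
      (hsmall L' hL'L) (hΔk L' hL'L) (fun ε _ _ x hx hb => by linarith [hroomB ε x hx hb, hmono L' hL'L])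
    -- conversion of the new patch to the level-(L'+1) parameters and labels
    have hnew' : ∀ x, InLayer x → InBox (tadd (offs L') (capv 0 ε (1, 1, -2))) (K₀ - (L' : ℤ) - 1) x →
        ∃ k : Fin N, ∃ M : EuclideanSpace ℝ (Fin 3) →ₗᵢ[ℝ] EuclideanSpace ℝ (Fin 3), ∃ Q : List T3,
          dist (y k) (y i) ≤ r ∧ νs (L' + 1) ≤ nearestDist y k ∧ nearestDist y k ≤ ν's (L' + 1) ∧
          ((P k = fccTwoShellPattern ∧ Q ∈ [Qa]) ∨ (P k = hcpTwoShellPattern ∧ Q ∈ [Qb])) ∧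
          Estab y A P B i k M Q (tadd (tadd (column lam₀ sg ((L' : ℤ) + 1)) (tadd (offs L') (capv 0 ε (1, 1, -2)))) x)
            (τs (L' + 1)) (Ds (L' + 1)) := by
      intro x hx hb
      obtain ⟨k, M, Q, h1, h2, h3, hQ, hE⟩ := hnew x hx hb
      rw [column_step] at hE
      exact ⟨k, M, Q, h1, by linarith [hν L' hL'L], by linarith [hν' L' hL'L], hQ, estab_mono hE (hτ L' hL'L) (hD L' hL'L)⟩
    have hroomU : ∀ x, InLayer x → InBox (tadd (offs L') (capv 0 ε (1, 1, -2))) (K₀ - (L' : ℤ) - 1) x →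
        ‖B (mv (tadd (tadd (column lam₀ sg ((L' : ℤ) + 1)) (tadd (offs L') (capv 0 ε (1, 1, -2)))) x))‖ +
          (Ds (L' + 1) + 1 / 10 ^ 4 * ν's (L' + 1) + τs (L' + 1)) ≤ r := by
      intro x hx hb
      rw [← column_step]
      exact hroomB ε x hx hb
    obtain ⟨C', hC', hunif⟩ := patch_uniform hy hP hA hf hinj hex hQb hnew' (hid L' hL'L) hroomU
    have hC'4 : C' ∈ [fccL, fccNegL, hcpL, hcpAltL] := by
      rcases hC' with rfl | rfl
      · exact hQa
      · rcases hQb with rfl | rfl <;> simp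
    -- the extended sequences
    refine ⟨fun m => if m ≤ L' then offs m else tadd (offs L') (capv 0 ε (1, 1, -2)), fun m => if m ≤ L' then Cs m else C', ?_, ?_, ?_, ?_⟩
    · dsimp only; rw [if_pos (Nat.zero_le _)]; exact h0
    · dsimp only; rw [if_pos (Nat.zero_le _)]; exact hC0
    · intro m hm
      dsimp only
      rcases Nat.lt_or_ge m L' with hlt | hge
      · rw [if_pos (Nat.succ_le_of_lt hlt), if_pos hlt.le, if_pos hlt.le]; exact hstep m hlt
      · have hmL : m = L' := le_antisymm (Nat.lt_succ_iff.1 hm) hge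
        subst hmL
        rw [if_neg (Nat.not_succ_le_self m), if_pos le_rfl, if_pos le_rfl]
        exact ⟨ε, hε, hcaps, rfl⟩
    · intro m hm
      dsimp only
      rcases Nat.lt_or_ge m (L' + 1) with hlt | hge
      · have hle : m ≤ L' := Nat.lt_succ_iff.1 hlt
        rw [if_pos hle, if_pos hle]
        exact hlev m hle
      · have hmL : m = L' + 1 := le_antisymm hm hge
        subst hmL
        rw [if_neg (Nat.not_succ_le_self L'), if_neg (Nat.not_succ_le_self L')]
        refine ⟨hC'4, ?_, fun x hx hb => ?_⟩
        · rw [thsum_tadd, hth, thsum_capv d0, mul_zero, add_zero]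
        · rw [hK1] at hb
          rw [hc1]
          exact hunif x hx hb

/-! ## §2  Base patches from regular discs -/

/-- A statement proved on the regular layer disc of hex radius `n` holds on the base box `InBox 0 (3n)` (the same set of layer vectors). [this file] -/
theorem patch_of_disc {Φ : T3 → Prop} {n : ℤ} (h : ∀ x, InLayer x → lnorm x ≤ 6 * n → Φ x) :
    ∀ x, InLayer x → InBox (0, 0, 0) (3 * n) x → Φ x :=
  fun x hx hb => h x hx (lnorm_le_of_inBox hx hb)

end Summit.AtomisticToContinuum.Crystallization.Theorems.OverbindingBudgetAffineCompressedCutRunBox
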